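import Summits.BirchSwinnertonDyer.BirchSwinnertonDyer.Theorems.OneSidedTwistSqueezeX9KatoDivisibilityX9PontryaginAnnihilator
import Summits.BirchSwinnertonDyer.Rank1Residual.GaloisImage.AbelianExtensionTorsion
import Summits.BirchSwinnertonDyer.Rank1Residual.O5.HeegnerLogTransportThreeResidualEngine
import Literature.NumberTheory.EllipticCurves.KatoFineSelmerFiniteProofs
import Literature.NumberTheory.EllipticCurves.SelmerInftyTorsionFiniteProofs
import Literature.NumberTheory.EllipticCurves.PointDivisibilityProofs
import Literature.NumberTheory.EllipticCurves.IwasawaNoFiniteSubmoduleProofs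
import Mathlib.RingTheory.Filtration
import Mathlib.RingTheory.Nakayama
import HarnessLib

set_option autoImplicit false

-- the summit and its single problem are both named `BirchSwinnertonDyer` (registry layout D-0017)
set_option linter.dupNamespace false

/-!
# Stub 1s `stub_testPairSupplyPkX9` of line `graded_euler_loss` (skeleton v4; crux `KatoDivisibilityX9` =
# stmt-BirchSwinnertonDyer-20547): TEST-PAIR SUPPLY WITH BOUNDED DEFECT (Artin–Rees + Nakayama + Pontryagin duality)

Seat `bsd-line-k6-p4` (prover-bsd-line-k6-p4-g5-0, 5th LEAD).  THEOREMS ONLY, sorry-free, no definition, no named fact;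
`--supports stmt-BirchSwinnertonDyer-20547` (registered stub `stub_testPairSupplyPkX9` of skeleton v4, sha16 e565e6f84b4fa2f5, =
hypothesis `hBD` of the landed bounded-defect assembly `…GradedCoreAssemblyDefect` p627676).  This is the NEW input of the v4
repair of the DEPTH obligation: v3's test-cocycle stub asked for EXACT test pairs (`T^{J+1} t = 0 ∧ T^J p^d t ≠ 0`), which the
dual fine Selmer shape `(p,T)·Λ/p²` does not have (g5 wave-1 verdict, p626333); pairs of BOUNDED DEFECT always exist.

THE ARGUMENT.  `S = Sel₀(ℚ_∞, E[p^∞])`, `θ = conj_γ − 1`, `X = X₀` a dual datum (`Y : W.FineSelmerDualData κ γ`, finitely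
generated over `Λ` — `FineSelmerDualData.module_finite`), `P = C p`, `T = X` in `Λ = ℤ_p⟦T⟧`.
* §1 COMPACT SIDE (`exists_defectBound`, any finitely generated `Λ`-module): with `M̄ = X/P^{d+1}X`, `A = im(P^d X) ≤ M̄` and the
  Artin–Rees constant `c` of `((T), A ≤ M̄)`: if `T^J P^d x₀ ∉ P^{d+1}X` for some `x₀`, then some `x` has
  `T^J P^d x ∉ T^{J+1+c} X + P^{d+1} X` — otherwise `T^J A ⊆ T^{J+1+c}M̄ ∩ A ⊆ T^{J+1} A`, so `T^J A = 0` by Nakayama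
  (`T ∈ 𝔪_Λ`), contradicting `x₀`.
* §2 THE STUB: given `y` with `ι_N y = p^n t`, `(conj_γ−1)^J y ≠ 0`: `t' = p^{n−d} t` has `θ^J(p^d t') ≠ 0` in `S` (injectivity of
  `ι_N : H¹(ℚ_∞, E[p]) → H¹(ℚ_∞, E[p^∞])` from `E(ℚ_∞)[p] = 0`: `Irr`, `p` odd, `ℚ_∞/ℚ` abelian) and `p^{d+1} t' = 0`, so by the
  EASY duality direction (`…PontryaginAnnihilator.exists_not_mem_of_witness`) `T^J P^d x₀ ∉ P^{d+1} X`; §1 gives `x` with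
  `T^J P^d x ∉ T^{J+1+c}X + P^{d+1}X`; the ANNIHILATOR computation (`…exists_eq_X_pow_smul_add_C_pow_smul`) gives
  `t₁ ∈ S[p^{d+1}, θ^{J+1+c}]` with `θ^J (p^d t₁) ≠ 0`; the Kummer lift (`exists_torsionToPrimaryH1Sub_eq`) of `p^d t₁` is the
  new `y'`.  `δ₀ := c`.

HONEST LABEL: closes the registered stub 1s of the DEPTH obligation; stubs 1a' / 1c' / width / F1_ζ and the crux stay OPEN;
PARTITION untouched; beyond-print theorem toward BSD: NO; no summit statement is proved by this seat; BSD is not proved by any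
of this.

References: R. Greenberg, LNM 1716 (1999) §1 p. 60 [GreenbergLNM1716]; L. Washington, GTM 83 §13.2 [Washington1997];
M. Atiyah, I. Macdonald, *Introduction to Commutative Algebra*, Prop. 10.9 (Artin–Rees), Prop. 2.6 (Nakayama) — Mathlib
`Ideal.exists_pow_inf_eq_pow_smul`, `Submodule.eq_bot_of_le_smul_of_le_jacobson_bot`.
-/

noncomputable section

open scoped Classical Pointwise
open WeierstrassCurve Field Function
open Literature.NumberTheory.GaloisRepresentations
open Literature.NumberTheory.EllipticCurves
open Summit.BirchSwinnertonDyer.BirchSwinnertonDyer.Rank1Residual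
open Summit.BirchSwinnertonDyer.BirchSwinnertonDyer.Theorems.OneSidedTwistSqueezeX9KatoDivisibilityX9PontryaginAnnihilator

namespace Summit.BirchSwinnertonDyer.BirchSwinnertonDyer.Theorems.OneSidedTwistSqueezeX9KatoDivisibilityX9StubTestPairSupplyPkX9

/-! ## §1 The compact side: Artin–Rees + Nakayama for `(T)` on `X/P^{d+1}X` -/

section Compact

variable {p : ℕ} [Fact p.Prime]

/-- **Defect bound (Artin–Rees + Nakayama).**  `X` a finitely generated `Λ`-module, `P = C p`, `T = X`, `d : ℕ`.  There is
`c` such that for every `J`: if `T^J P^d x₀ ∉ P^{d+1} X` for some `x₀`, then `T^J P^d x ∉ T^{J+1+c} X + P^{d+1} X` for some `x`.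
[folklore] -/
theorem exists_defectBound (X : Type*) [AddCommGroup X] [Module (IwasawaAlgebra p) X]
    [Module.Finite (IwasawaAlgebra p) X] (d : ℕ) :
    ∃ c : ℕ, ∀ J : ℕ, ∀ x₀ : X,
      (∀ x' : X, (PowerSeries.X : IwasawaAlgebra p) ^ J •
        ((PowerSeries.C (p : ℤ_[p]) : IwasawaAlgebra p) ^ d • x₀) ≠
          (PowerSeries.C (p : ℤ_[p]) : IwasawaAlgebra p) ^ (d + 1) • x') →
      ∃ x : X, ∀ x₁ x₂ : X, (PowerSeries.X : IwasawaAlgebra p) ^ J •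
        ((PowerSeries.C (p : ℤ_[p]) : IwasawaAlgebra p) ^ d • x) ≠
          (PowerSeries.X : IwasawaAlgebra p) ^ (J + 1 + c) • x₁ +
            (PowerSeries.C (p : ℤ_[p]) : IwasawaAlgebra p) ^ (d + 1) • x₂ := by
  set P : IwasawaAlgebra p := PowerSeries.C (p : ℤ_[p]) with hPdef
  set Tv : IwasawaAlgebra p := PowerSeries.X with hTvdef
  let N₀ : Submodule (IwasawaAlgebra p) X := (P ^ (d + 1)) • (⊤ : Submodule (IwasawaAlgebra p) X)
  let A : Submodule (IwasawaAlgebra p) (X ⧸ N₀) := Submodule.map N₀.mkQ ((P ^ d) • (⊤ : Submodule _ X))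
  let I : Ideal (IwasawaAlgebra p) := Ideal.span {Tv}
  obtain ⟨c, hc⟩ := I.exists_pow_inf_eq_pow_smul A
  refine ⟨c, fun J x₀ hx₀ => ?_⟩
  by_contra hall
  push Not at hall
  -- every `T^J a`, `a ∈ A`, lies in `T^{J+1+c} M̄`
  have hI : ∀ m : ℕ, I ^ m = Ideal.span {Tv ^ m} := fun m => Ideal.span_singleton_pow Tv m
  have hle : I ^ J • A ≤ I ^ (J + 1 + c) • ⊤ := by
    rw [hI, Submodule.ideal_span_singleton_smul, hI, Submodule.ideal_span_singleton_smul]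
    intro m hm
    rw [Submodule.mem_smul_pointwise_iff_exists] at hm
    obtain ⟨a, ha, rfl⟩ := hm
    rw [Submodule.mem_map] at ha
    obtain ⟨w, hw, rfl⟩ := ha
    rw [Submodule.mem_smul_pointwise_iff_exists] at hw
    obtain ⟨x, -, rfl⟩ := hw
    obtain ⟨x₁, x₂, hx⟩ := hall x
    rw [Submodule.mem_smul_pointwise_iff_exists]
    refine ⟨N₀.mkQ x₁, Submodule.mem_top, ?_⟩
    rw [← map_smul, ← map_smul, Submodule.mkQ_apply, Submodule.mkQ_apply, Submodule.Quotient.eq, hx]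
    have : Tv ^ (J + 1 + c) • x₁ - (Tv ^ (J + 1 + c) • x₁ + P ^ (d + 1) • x₂) = -(P ^ (d + 1) • x₂) := by abel
    rw [this]
    exact N₀.neg_mem (Submodule.smul_mem_pointwise_smul _ _ _ Submodule.mem_top)
  -- Artin–Rees: `T^J A ⊆ T^{J+1+c} M̄ ∩ A = T^{J+1} (T^c M̄ ∩ A) ⊆ T · T^J A`
  have hN : I ^ J • A ≤ I • (I ^ J • A) := by
    have h1 : I ^ J • A ≤ I ^ (J + 1 + c) • ⊤ ⊓ A := le_inf hle Submodule.smul_le_right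
    rw [hc (J + 1 + c) (by omega), show J + 1 + c - c = J + 1 by omega] at h1
    refine h1.trans ?_
    rw [pow_succ', Submodule.mul_smul]
    exact Submodule.smul_mono le_rfl (Submodule.smul_mono le_rfl inf_le_right)
  -- Nakayama
  haveI : IsNoetherian (IwasawaAlgebra p) (X ⧸ N₀) := isNoetherian_of_isNoetherianRing_of_finite _ _
  have hIjac : I ≤ (⊥ : Ideal (IwasawaAlgebra p)).jacobson := by
    rw [IsLocalRing.jacobson_eq_maximalIdeal ⊥ bot_ne_top]
    exact Ideal.span_le.mpr (Set.singleton_subset_iff.mpr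
      (Literature.NumberTheory.EllipticCurves.IwasawaAlgebra.X_mem_maximalIdeal' (p := p)))
  have hbot : I ^ J • A = ⊥ :=
    Submodule.eq_bot_of_le_smul_of_le_jacobson_bot I (I ^ J • A) (IsNoetherian.noetherian _) hN hIjac
  -- contradiction with `x₀`
  have hmem : Tv ^ J • N₀.mkQ (P ^ d • x₀) ∈ I ^ J • A := by
    rw [hI, Submodule.ideal_span_singleton_smul]
    exact Submodule.smul_mem_pointwise_smul _ _ _ ⟨P ^ d • x₀,
      Submodule.smul_mem_pointwise_smul _ _ _ Submodule.mem_top, rfl⟩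
  rw [hbot, Submodule.mem_bot, ← map_smul, Submodule.mkQ_apply, Submodule.Quotient.mk_eq_zero,
    Submodule.mem_smul_pointwise_iff_exists] at hmem
  obtain ⟨x', -, hx'⟩ := hmem
  exact hx₀ x' hx'.symm

end Compact

/-! ## §2 The registered stub `stub_testPairSupplyPkX9` (hypothesis `hBD` of the bounded-defect assembly) -/

section Stub

open scoped NumberField

/-- `p` kills `H¹(K_∞, E[p])` (the coefficients are `p`-torsion). [folklore] -/
theorem prime_nsmul_subgroupH1_geomTorsion_eq_zero {K : Type} [Field K] (W : WeierstrassCurve K) (p : ℕ) [Fact p.Prime]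
    (H : Subgroup (absoluteGaloisGroup K))
    (y : Literature.NumberTheory.EllipticCurves.subgroupH1 H (geomTorsion W (p : ℤ))) : p • y = 0 := by
  obtain ⟨φ, rfl⟩ := oneCocycleClass_surjective _ y
  have h := oneCocycleClass_smul (discreteTopRep H (geomTorsion W (p : ℤ))) (p : ℤ) φ
  conv at h => rhs; rw [Nat.cast_smul_eq_nsmul]
  rw [← h]
  have h0 : (p : ℤ) • φ = 0 := by
    refine Subtype.ext (ContinuousMap.ext fun g => ?_)
    change (p : ℤ) • φ.1 g = 0
    rw [natCast_zsmul, AddSubgroup.torsionBy.nsmul]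
  rw [h0, oneCocycleClass_zero]

/-- **STUB 1s of line `graded_euler_loss` (skeleton v4) — TEST-PAIR SUPPLY WITH BOUNDED DEFECT** (verbatim the registered
signature = hypothesis `hBD` of `…GradedCoreAssemblyDefect.fineCoreGraded_of_supply_of_testCocycle_of_kolyvaginPrime_of_reciprocity`).
`δ₀ :=` the Artin–Rees constant of §1 for a dual fine Selmer datum `Y` and `d`.  (The `¬Surj` and cyclotomic binders are not
used.) [cite: GreenbergLNM1716, §1 p. 60 (after Conj. 1.3)] [cite: Washington1997, §13.2] -/
theorem stub_testPairSupplyPkX9 : ∀ (W : WeierstrassCurve ℚ) [W.IsElliptic] [W.IsGloballyMinimal] (p : ℕ) [Fact p.Prime]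
      (κ : ZpExtension ℚ p) (γ : absoluteGaloisGroup ℚ) (n d : ℕ), d ≤ n →
      p ≠ 2 → W.HasIrreducibleModPGaloisRep p → ¬ W.HasSurjectiveModNGaloisRep p →
      κ.IsCyclotomic → κ.IsTopGenerator γ →
      ∃ δ₀ : ℕ, ∀ J : ℕ,
        (∃ y : Literature.NumberTheory.EllipticCurves.subgroupH1 κ.kerSubgroup (geomTorsion W (p : ℤ)),
          (∃ t : W.fineSelmerInfty κ,
            W.torsionToPrimaryH1Sub p κ.kerSubgroup y = p ^ n • (t : W.subgroupH1 p κ.kerSubgroup)) ∧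
          (⇑(Literature.NumberTheory.EllipticCurves.conjH1 κ.kerSubgroup (geomTorsion W (p : ℤ)) γ -
            AddMonoidHom.id (Literature.NumberTheory.EllipticCurves.subgroupH1 κ.kerSubgroup
              (geomTorsion W (p : ℤ)))))^[J] y ≠ 0) →
        ∃ y : Literature.NumberTheory.EllipticCurves.subgroupH1 κ.kerSubgroup (geomTorsion W (p : ℤ)),
          (∃ t : W.fineSelmerInfty κ,
            W.torsionToPrimaryH1Sub p κ.kerSubgroup y = p ^ d • (t : W.subgroupH1 p κ.kerSubgroup) ∧
            (⇑(W.conjH1 p κ.kerSubgroup γ - AddMonoidHom.id (W.subgroupH1 p κ.kerSubgroup)))^[J + 1 + δ₀]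
              (t : W.subgroupH1 p κ.kerSubgroup) = 0) ∧
          (⇑(Literature.NumberTheory.EllipticCurves.conjH1 κ.kerSubgroup (geomTorsion W (p : ℤ)) γ -
            AddMonoidHom.id (Literature.NumberTheory.EllipticCurves.subgroupH1 κ.kerSubgroup
              (geomTorsion W (p : ℤ)))))^[J] y ≠ 0 := by
  intro W _ _ p _ κ γ n d hdn hp2 hirr _ _ hγ
  have hp : p.Prime := Fact.out
  -- the dual datum and its finite generation
  obtain ⟨Y⟩ := W.nonempty_fineSelmerDualData κ hγ
  haveI : Module.Finite (IwasawaAlgebra p) Y.X := WeierstrassCurve.FineSelmerDualData.module_finite W κ hγ Y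
  obtain ⟨c, hc⟩ := exists_defectBound (p := p) Y.X d
  refine ⟨c, fun J hJ => ?_⟩
  obtain ⟨y, ⟨t, hyt⟩, hyT⟩ := hJ
  -- naturality of `ι_N` with the iterates of `conj_γ − id`
  have hnat : ∀ (m : ℕ) (z : Literature.NumberTheory.EllipticCurves.subgroupH1 κ.kerSubgroup (geomTorsion W (p : ℤ))),
      W.torsionToPrimaryH1Sub p κ.kerSubgroup
        ((⇑(Literature.NumberTheory.EllipticCurves.conjH1 κ.kerSubgroup (geomTorsion W (p : ℤ)) γ -
          AddMonoidHom.id (Literature.NumberTheory.EllipticCurves.subgroupH1 κ.kerSubgroup (geomTorsion W (p : ℤ)))))^[m] z) =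
      (⇑(W.conjH1 p κ.kerSubgroup γ - AddMonoidHom.id (W.subgroupH1 p κ.kerSubgroup)))^[m]
        (W.torsionToPrimaryH1Sub p κ.kerSubgroup z) := by
    intro m z
    induction m generalizing z with
    | zero => rfl
    | succ m ih =>
      rw [Function.iterate_succ_apply', Function.iterate_succ_apply', ← ih, AddMonoidHom.sub_apply,
        AddMonoidHom.sub_apply, AddMonoidHom.id_apply, AddMonoidHom.id_apply, map_sub,
        W.conjH1_torsionToPrimaryH1Sub]
  -- injectivity of `ι_N` (`E(ℚ_∞)[p^∞]` has no `p`-torsion: `Irr`, `p` odd, `ℚ_∞/ℚ` abelian)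
  have hinj : Function.Injective (W.torsionToPrimaryH1Sub p κ.kerSubgroup) := by
    refine Summit.BirchSwinnertonDyer.Rank1Residual.O5.HeegnerLogTransport.torsionToPrimaryH1Sub_injective_of_fixed W p
      κ.kerSubgroup fun m hm hpm => ?_
    apply Subtype.ext
    exact Summit.BirchSwinnertonDyer.Rank1Residual.GaloisImage.geomPoints_eq_zero_of_fixed_of_pow_smul_eq_zero W p hp2
      hirr (Abelianization.commutator_subset_ker _) (m : geomPoints W)
      (fun σ hσ => congrArg Subtype.val (hm σ hσ)) 1
      (by rw [pow_one, ← AddSubgroupClass.coe_nsmul, hpm, ZeroMemClass.coe_zero])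
  -- (a) the discrete witness `t' = p^{n-d} t`: `p^{d+1} t' = 0` and `θ^J (p^d t') ≠ 0`
  have hdt' : p ^ d • (p ^ (n - d) • t) = p ^ n • t := by
    rw [← mul_nsmul', ← pow_add, Nat.add_sub_cancel' hdn]
  have hpt' : p ^ (d + 1) • (p ^ (n - d) • t) = 0 := by
    rw [pow_succ', mul_nsmul', hdt']
    apply Subtype.ext
    rw [AddSubgroupClass.coe_nsmul, AddSubgroupClass.coe_nsmul, ← hyt, ← map_nsmul,
      prime_nsmul_subgroupH1_geomTorsion_eq_zero, map_zero, ZeroMemClass.coe_zero]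
  have hθ' : ((W.conjFineSelmerInfty κ γ - 1) ^ J) (p ^ d • (p ^ (n - d) • t)) ≠ 0 := by
    intro h0
    apply hyT
    apply hinj
    rw [map_zero, hnat, hyt, ← AddSubgroupClass.coe_nsmul, ← hdt',
      ← coe_conjFineSelmerInfty_sub_one_pow_apply W κ γ J (p ^ d • (p ^ (n - d) • t)), h0, ZeroMemClass.coe_zero]
  -- (b) easy duality: `T^J P^d x₀ ∉ P^{d+1} X`
  obtain ⟨x₀, hx₀⟩ := exists_not_mem_of_witness W κ Y (p ^ (n - d) • t) hpt' hθ'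
  -- (c) compact side: `T^J P^d x ∉ T^{J+1+c} X + P^{d+1} X`
  obtain ⟨x, hx⟩ := hc J x₀ hx₀
  -- (d) annihilator: a `t₁ ∈ S[p^{d+1}, θ^{J+1+c}]` with `θ^J (p^d t₁) ≠ 0`
  have hex : ∃ t₁ : W.fineSelmerInfty κ, p ^ (d + 1) • t₁ = 0 ∧ ((W.conjFineSelmerInfty κ γ - 1) ^ (J + 1 + c)) t₁ = 0 ∧
      ((W.conjFineSelmerInfty κ γ - 1) ^ J) (p ^ d • t₁) ≠ 0 := by
    by_contra hnone
    push Not at hnone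
    obtain ⟨x₁, x₂, hx12⟩ := exists_eq_X_pow_smul_add_C_pow_smul W κ Y (d + 1) (J + 1 + c)
      ((PowerSeries.X : IwasawaAlgebra p) ^ J • ((PowerSeries.C (p : ℤ_[p]) : IwasawaAlgebra p) ^ d • x))
      fun t₁ h1 h2 => by
        rw [toDual_X_pow_smul, toDual_C_pow_smul, ← map_nsmul, hnone t₁ h1 h2, map_zero]
    exact hx x₁ x₂ hx12
  obtain ⟨t₁, ht₁p, ht₁θ, ht₁J⟩ := hex
  -- (e) back to `H¹(ℚ_∞, E[p])`: the Kummer lift of `p^d t₁`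
  have hpu : p • ((p ^ d • t₁ : W.fineSelmerInfty κ) : W.subgroupH1 p κ.kerSubgroup) = 0 := by
    rw [← AddSubgroupClass.coe_nsmul, ← mul_nsmul', ← pow_succ', ht₁p, ZeroMemClass.coe_zero]
  obtain ⟨y', hy'⟩ := W.exists_torsionToPrimaryH1Sub_eq p (H := κ.kerSubgroup) W.zsmul_geomPoints_surjective_holds hpu
  refine ⟨y', ⟨t₁, ?_, ?_⟩, ?_⟩
  · rw [hy', AddSubgroupClass.coe_nsmul]
  · rw [← coe_conjFineSelmerInfty_sub_one_pow_apply W κ γ (J + 1 + c) t₁, ht₁θ, ZeroMemClass.coe_zero]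
  · intro h0
    apply ht₁J
    have h1 := hnat J y'
    rw [h0, map_zero, hy', ← coe_conjFineSelmerInfty_sub_one_pow_apply W κ γ J] at h1
    exact Subtype.ext (by rw [ZeroMemClass.coe_zero]; exact h1.symm)

end Stub

end Summit.BirchSwinnertonDyer.BirchSwinnertonDyer.Theorems.OneSidedTwistSqueezeX9KatoDivisibilityX9StubTestPairSupplyPkX9

end
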